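import Mathlib.LinearAlgebra.CrossProduct
import Mathlib.Analysis.SpecialFunctions.Pow.Real
import HarnessLib

/-!
# K2R `RealisedQuasiStaticCellLaw`, line `floquet-bloch`: lower bound for the cosines between consecutive frequencies of a
# principal coset (the `γ²` of the in-plane block; helper towards `stub_lowSectorDecay`; `--supports stmt-AnomalousDissipation-20446`)

Summits-side helper file (everything proved; no definitions, no named facts; elementary real inequalities on `Fin 3 → ℝ` with the
dot product; Cauchy–Schwarz is derived inline from Lagrange's identity `cross_dot_cross`). For `k₀, K` with `a² = k₀·k₀ > 0`, `b² = K·K`, and the neighbours `k₀ ± K` of `k₀` on the coset `k₀ + ℤK`: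
`|k₀·(k₀ ± K)| ≥ |k₀·K| − a²` and `√((k₀ ± K)·(k₀ ± K)) ≤ a + b`, whence the normalised cosine
`|k̂₀·k̂_{±1}| = |k₀·(k₀ ± K)| / (a √((k₀±K)·(k₀±K))) ≥ (|k₀·K| − a²)/(a(a+b))` (`cos_coset_neighbour_ge`). With
`inPlane_link_eq_cos` (`…CosetGeometry`) this bounds the `γ² = (k̂₀·k̂₁)² + (k̂₋₁·k̂₀)²` of `inPlane_block_decay` from below by
`2((|k̂₀·K̂| b − a)/(a + b))²` — recipe H4 of the S1D far-sector assembly (`|k̂₀·K̂| ≥ √(7/130)` in a good slot, `a ≪ b`).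
-/

set_option linter.dupNamespace false

noncomputable section

namespace Summit.AnomalousDissipation.AnomalousDissipation.Theorems.SolenoidalFractalHomogenisation.RealisedQuasiStaticCellLaw

open Matrix
open scoped Matrix

/-- The norm of a sum: `√((u+v)·(u+v)) ≤ √(u·u) + √(v·v)`. -/
theorem sqrt_dotProduct_add_le (u v : Fin 3 → ℝ) :
    Real.sqrt ((u + v) ⬝ᵥ (u + v)) ≤ Real.sqrt (u ⬝ᵥ u) + Real.sqrt (v ⬝ᵥ v) := by
  have hnn : ∀ w : Fin 3 → ℝ, 0 ≤ w ⬝ᵥ w := fun w => by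
    have e : w ⬝ᵥ w = ∑ i, w i ^ 2 := by simp [dotProduct, sq]
    rw [e]; exact Finset.sum_nonneg fun i _ => sq_nonneg (w i)
  have hu := hnn u
  have hv := hnn v
  -- Cauchy–Schwarz from Lagrange's identity `(u·u)(v·v) − (u·v)² = |u × v|²`
  have hcs : (u ⬝ᵥ v) ^ 2 ≤ (u ⬝ᵥ u) * (v ⬝ᵥ v) := by
    have h := cross_dot_cross u v u v
    have h0 := hnn (u ⨯₃ v)
    rw [h, dotProduct_comm v u] at h0
    nlinarith
  rw [Real.sqrt_le_left (by positivity)]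
  have e : (u + v) ⬝ᵥ (u + v) = u ⬝ᵥ u + 2 * (u ⬝ᵥ v) + v ⬝ᵥ v := by
    rw [add_dotProduct, dotProduct_add, dotProduct_add, dotProduct_comm v u]; ring
  rw [e, add_sq, Real.sq_sqrt hu, Real.sq_sqrt hv]
  have h2 : u ⬝ᵥ v ≤ Real.sqrt (u ⬝ᵥ u) * Real.sqrt (v ⬝ᵥ v) := by
    rw [← Real.sqrt_mul hu]
    exact Real.le_sqrt_of_sq_le hcs
  nlinarith

/-- **Cosine between a coset frequency and its neighbour.** For `k₀` with `a = √(k₀·k₀) > 0`, `b = √(K·K)` and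
`k₁ = k₀ + K`: `(|k₀·K| − a²)/(a(a+b)) ≤ |k₀·k₁| / (a √(k₁·k₁))` (the right side is `|k̂₀·k̂₁|` when `k₁ ≠ 0`). -/
theorem cos_coset_neighbour_ge (k0 K : Fin 3 → ℝ) (ha : 0 < k0 ⬝ᵥ k0) (hb : 0 < K ⬝ᵥ K) :
    (|k0 ⬝ᵥ K| - k0 ⬝ᵥ k0) / (Real.sqrt (k0 ⬝ᵥ k0) * (Real.sqrt (k0 ⬝ᵥ k0) + Real.sqrt (K ⬝ᵥ K))) ≤
      |k0 ⬝ᵥ (k0 + K)| / (Real.sqrt (k0 ⬝ᵥ k0) * Real.sqrt ((k0 + K) ⬝ᵥ (k0 + K))) := by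
  set a := Real.sqrt (k0 ⬝ᵥ k0) with hadef
  set b := Real.sqrt (K ⬝ᵥ K) with hbdef
  have ha0 : 0 < a := Real.sqrt_pos.2 ha
  have hb0 : 0 < b := Real.sqrt_pos.2 hb
  have hasq : a ^ 2 = k0 ⬝ᵥ k0 := Real.sq_sqrt ha.le
  -- numerator: `|k₀·k₁| ≥ |k₀·K| − a²`
  have hnum : |k0 ⬝ᵥ K| - k0 ⬝ᵥ k0 ≤ |k0 ⬝ᵥ (k0 + K)| := by
    rw [dotProduct_add]
    have := abs_sub_abs_le_abs_sub (k0 ⬝ᵥ K) (-(k0 ⬝ᵥ k0))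
    rw [abs_neg, abs_of_nonneg ha.le, sub_neg_eq_add, add_comm (k0 ⬝ᵥ K)] at this
    linarith
  -- denominator: `√(k₁·k₁) ≤ a + b`
  have hden : Real.sqrt ((k0 + K) ⬝ᵥ (k0 + K)) ≤ a + b := sqrt_dotProduct_add_le k0 K
  have hden0 : 0 ≤ Real.sqrt ((k0 + K) ⬝ᵥ (k0 + K)) := Real.sqrt_nonneg _
  by_cases hk1 : Real.sqrt ((k0 + K) ⬝ᵥ (k0 + K)) = 0
  · -- degenerate neighbour `k₁ = 0`: then `K = -k₀`, `|k₀·K| = a²`, left side is `0`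
    have hzero : (k0 + K) ⬝ᵥ (k0 + K) = 0 := by
      have h0 : 0 ≤ (k0 + K) ⬝ᵥ (k0 + K) := by
        have e : (k0 + K) ⬝ᵥ (k0 + K) = ∑ i, (k0 + K) i ^ 2 := by simp [dotProduct, sq]
        rw [e]; exact Finset.sum_nonneg fun i _ => sq_nonneg ((k0 + K) i)
      rwa [Real.sqrt_eq_zero h0] at hk1
    have hKk : K = -k0 := by
      have : ∀ i, (k0 + K) i = 0 := by
        have e : (k0 + K) ⬝ᵥ (k0 + K) = ∑ i, (k0 + K) i ^ 2 := by simp [dotProduct, sq]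
        rw [e] at hzero
        intro i
        have := (Finset.sum_eq_zero_iff_of_nonneg (fun j _ => sq_nonneg ((k0 + K) j))).1 hzero i (Finset.mem_univ i)
        exact pow_eq_zero_iff (n := 2) (by norm_num) |>.1 this
      funext i; have := this i; simp only [Pi.add_apply] at this; simp only [Pi.neg_apply]; linarith
    have hl : |k0 ⬝ᵥ K| - k0 ⬝ᵥ k0 = 0 := by
      rw [hKk, dotProduct_neg, abs_neg, abs_of_nonneg ha.le, sub_self]
    rw [hl, zero_div, hk1, mul_zero, div_zero]
  · have hden1 : 0 < Real.sqrt ((k0 + K) ⬝ᵥ (k0 + K)) := lt_of_le_of_ne hden0 (Ne.symm hk1)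
    rw [div_le_div_iff₀ (by positivity) (by positivity)]
    by_cases hsign : |k0 ⬝ᵥ K| - k0 ⬝ᵥ k0 ≤ 0
    · -- left numerator non-positive: trivial
      have h1 : (|k0 ⬝ᵥ K| - k0 ⬝ᵥ k0) * (a * Real.sqrt ((k0 + K) ⬝ᵥ (k0 + K))) ≤ 0 :=
        mul_nonpos_of_nonpos_of_nonneg hsign (by positivity)
      have h2 : 0 ≤ |k0 ⬝ᵥ (k0 + K)| * (a * (a + b)) := by positivity
      linarith
    · push Not at hsign
      calc (|k0 ⬝ᵥ K| - k0 ⬝ᵥ k0) * (a * Real.sqrt ((k0 + K) ⬝ᵥ (k0 + K)))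
          ≤ (|k0 ⬝ᵥ K| - k0 ⬝ᵥ k0) * (a * (a + b)) :=
            mul_le_mul_of_nonneg_left (mul_le_mul_of_nonneg_left hden ha0.le) hsign.le
        _ ≤ |k0 ⬝ᵥ (k0 + K)| * (a * (a + b)) := mul_le_mul_of_nonneg_right hnum (by positivity)

/-- The same bound for the other neighbour `k₋₁ = k₀ − K`. -/
theorem cos_coset_neighbour_ge' (k0 K : Fin 3 → ℝ) (ha : 0 < k0 ⬝ᵥ k0) (hb : 0 < K ⬝ᵥ K) :
    (|k0 ⬝ᵥ K| - k0 ⬝ᵥ k0) / (Real.sqrt (k0 ⬝ᵥ k0) * (Real.sqrt (k0 ⬝ᵥ k0) + Real.sqrt (K ⬝ᵥ K))) ≤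
      |k0 ⬝ᵥ (k0 - K)| / (Real.sqrt (k0 ⬝ᵥ k0) * Real.sqrt ((k0 - K) ⬝ᵥ (k0 - K))) := by
  have h := cos_coset_neighbour_ge k0 (-K) ha (by rwa [neg_dotProduct, dotProduct_neg, neg_neg])
  simp only [dotProduct_neg, neg_dotProduct, neg_neg, abs_neg, ← sub_eq_add_neg] at h
  exact h

end Summit.AnomalousDissipation.AnomalousDissipation.Theorems.SolenoidalFractalHomogenisation.RealisedQuasiStaticCellLaw

end
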